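import Mathlib

/-!
# ARM B, row kind M (MODEL rows): finite-dimensional Lyapunov certificates — schema, exact check and
  SOUNDNESS (`ModelNoPeriodicOrbitBelow`)

Engine-declared quadratic Galerkin MODEL `x' = A x + Q(x,x)` on `ℚⁿ` (the correspondence to a level-`N`
truncation of Leray's similarity-variable system in a declared basis is ENGINE METADATA, not a kernel
fact).  A `LyapRow` carries `(A, Q, P, κ, Mth)` and exact `LDLᵀ` data; `LyapRow.check` verifies in exact
rational arithmetic `P − I = L₁D₁L₁ᵀ (D₁ ≥ 0)`, `−(AᵀP + PA) − κI = L₂D₂L₂ᵀ (D₂ ≥ 0)`, `0 < κ`, `0 < Mth`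
and `2‖P‖₁‖Q‖₁·Mth < κ` (entrywise `ℓ¹` norms).  **Soundness (PROVED here, no stub):**
`LyapRow.sound : r.check = true → ModelNoPeriodicOrbitBelow r.model r.Mth` — the model has no non-zero
periodic orbit (no truncated DSS profile of ANY factor) whose Euclidean Galerkin energy stays `≤ Mth`:
`V = xᵀPx` has `V' ≤ −(κ − 2‖P‖₁‖Q‖₁Mth)|x|² ≤ 0`, a periodic antitone function is constant, so `V' ≡ 0`
and `x ≡ 0`.

HONEST FRAMING: finite-dimensional ODE facts about an engine-supplied MODEL; MODEL numbers are never PDE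
numbers; nothing here bears on Navier–Stokes regularity.
-/

noncomputable section

set_option linter.dupNamespace false

namespace Summit.NavierStokesRegularity.NavierStokesRegularity.Cruxes.ScarEnvelopeTypeI.DssWindowCert

open Finset Matrix

/-! ## Schema -/
/-- Matrix entry access (row-major arrays) with default `0`. -/
def ent (M : Array (Array ℚ)) (i j : ℕ) : ℚ := (M.getD i #[]).getD j 0

/-- An engine-supplied quadratic MODEL `x' = A x + Q(x,x)` on `ℚⁿ`. -/
structure QuadModel where
  /-- dimension -/ n : ℕ
  /-- truncation level (metadata) -/ level : ℕ
  /-- basis / symmetry-class tag (metadata) -/ basis : String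
  /-- linear part, row-major `n × n` -/ A : Array (Array ℚ)
  /-- quadratic part: `Q[i][j][k]` = coefficient of `x_j x_k` in component `i` -/ Q : Array (Array (Array ℚ))
/-- Linear coefficient `A i j` (default `0`). -/
def QuadModel.a (m : QuadModel) (i j : ℕ) : ℚ := ent m.A i j
/-- Quadratic coefficient `Q i j k` (default `0`). -/
def QuadModel.q (m : QuadModel) (i j k : ℕ) : ℚ := ((m.Q.getD i #[]).getD j #[]).getD k 0
/-- Entrywise `ℓ¹` norm of `Q`. -/
def QuadModel.qNorm1 (m : QuadModel) : ℚ :=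
  ∑ i ∈ range m.n, ∑ j ∈ range m.n, ∑ k ∈ range m.n, |m.q i j k|
/-- The quadratic part of the model field over `ℝ`. -/
def QuadModel.quad (m : QuadModel) (x : Fin m.n → ℝ) : Fin m.n → ℝ :=
  fun i => ∑ j : Fin m.n, ∑ k : Fin m.n, (m.q i j k : ℝ) * x j * x k

/-- The model vector field over `ℝ`: `F(x)_i = Σ_j A_ij x_j + Σ_{j,k} Q_ijk x_j x_k`. -/
def QuadModel.field (m : QuadModel) (x : Fin m.n → ℝ) : Fin m.n → ℝ :=
  fun i => (∑ j : Fin m.n, (m.a i j : ℝ) * x j) + m.quad x i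

/-- **MODEL statement**: the model has no non-zero periodic orbit whose Euclidean Galerkin energy stays
below the threshold `Mth` — i.e. no truncated DSS profile of ANY factor below `Mth`. -/
def ModelNoPeriodicOrbitBelow (m : QuadModel) (Mth : ℝ) : Prop :=
  ∀ (S : ℝ) (x : ℝ → Fin m.n → ℝ), 0 < S → Function.Periodic x S →
    (∀ s, HasDerivAt x (m.field (x s)) s) → (∀ s, ∑ i, x s i ^ 2 ≤ Mth ^ 2) → ∀ s, x s = 0

/-- A MODEL (Lyapunov) ROW. -/
structure LyapRow where
  /-- the model -/ model : QuadModel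
  /-- Lyapunov matrix `P` (row-major) -/ P : Array (Array ℚ)
  /-- coercivity constant `κ` of `−(AᵀP + PA) ≽ κ I` -/ κ : ℚ
  /-- energy threshold -/ Mth : ℚ
  /-- factor `L₁` of `P − I = L₁ D₁ L₁ᵀ` -/ L₁ : Array (Array ℚ)
  /-- diagonal `D₁ ≥ 0` -/ D₁ : Array ℚ
  /-- factor `L₂` of `−(AᵀP + PA) − κ I = L₂ D₂ L₂ᵀ` -/ L₂ : Array (Array ℚ)
  /-- diagonal `D₂ ≥ 0` -/ D₂ : Array ℚ

/-- `(L D Lᵀ)_{ij}` computed from the factors. -/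
def ldlt (L : Array (Array ℚ)) (D : Array ℚ) (n i j : ℕ) : ℚ :=
  ∑ k ∈ range n, ent L i k * D.getD k 0 * ent L j k

/-- Exact check that `M = L D Lᵀ` entrywise on `n × n` with `D ≥ 0` (hence `M ≽ 0`). -/
def psdCheck (n : ℕ) (M : ℕ → ℕ → ℚ) (L : Array (Array ℚ)) (D : Array ℚ) : Bool :=
  (List.range n).all (fun k => decide (0 ≤ D.getD k 0)) &&
  (List.range n).all (fun i => (List.range n).all (fun j => decide (M i j = ldlt L D n i j)))

/-- Dimension of the row's model. -/
abbrev LyapRow.n (r : LyapRow) : ℕ := r.model.n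

/-- `P i j`. -/
def LyapRow.p (r : LyapRow) (i j : ℕ) : ℚ := ent r.P i j

/-- `(P − I) i j`. -/
def LyapRow.pMinusI (r : LyapRow) (i j : ℕ) : ℚ := r.p i j - if i = j then 1 else 0

/-- `(−(AᵀP + PA) − κ I) i j`. -/
def LyapRow.sMat (r : LyapRow) (i j : ℕ) : ℚ :=
  -(∑ k ∈ range r.n, (r.model.a k i * r.p k j + r.p i k * r.model.a k j)) - if i = j then r.κ else 0

/-- Entrywise `ℓ¹` norm of `P`. -/
def LyapRow.pNorm1 (r : LyapRow) : ℚ := ∑ i ∈ range r.n, ∑ j ∈ range r.n, |r.p i j|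

/-- The total Boolean check of a model row. -/
def LyapRow.check (r : LyapRow) : Bool :=
  psdCheck r.n r.pMinusI r.L₁ r.D₁ && psdCheck r.n r.sMat r.L₂ r.D₂ &&
    decide (0 < r.κ) && decide (0 < r.Mth) && decide (2 * r.pNorm1 * r.model.qNorm1 * r.Mth < r.κ)

/-! ## Soundness, step 1: positive semidefiniteness from an exact `LDLᵀ` identity -/
/-- `vᵀ M v` as a double sum. -/
theorem dotProduct_mulVec_eq_sum {n : ℕ} (M : Matrix (Fin n) (Fin n) ℝ) (v : Fin n → ℝ) :
    v ⬝ᵥ (M *ᵥ v) = ∑ i, ∑ j, M i j * v i * v j := by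
  simp only [dotProduct, Matrix.mulVec, Finset.mul_sum]
  refine Finset.sum_congr rfl fun i _ => Finset.sum_congr rfl fun j _ => ?_
  ring

/-- A passing `psdCheck` makes the quadratic form of `M` non-negative. -/
theorem psd_of_psdCheck {n : ℕ} {M : ℕ → ℕ → ℚ} {L : Array (Array ℚ)} {D : Array ℚ}
    (h : psdCheck n M L D = true) (v : Fin n → ℝ) :
    0 ≤ ∑ i : Fin n, ∑ j : Fin n, (M i j : ℝ) * v i * v j := by
  simp only [psdCheck, Bool.and_eq_true, List.all_eq_true, List.mem_range, decide_eq_true_eq] at h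
  obtain ⟨hD, hM⟩ := h
  set Lm : Matrix (Fin n) (Fin n) ℝ := Matrix.of fun i k : Fin n => (ent L i k : ℝ) with hLm
  set d : Fin n → ℝ := fun k => (D.getD k 0 : ℝ) with hd
  set Mm : Matrix (Fin n) (Fin n) ℝ := Matrix.of fun i j : Fin n => (M i j : ℝ) with hMm0
  have hMm : Mm = Lm * Matrix.diagonal d * Lmᵀ := by
    ext i j
    have hij := hM i i.isLt j j.isLt
    rw [Matrix.mul_apply]
    simp only [hMm0, hLm, hd, Matrix.of_apply, Matrix.mul_diagonal, Matrix.transpose_apply, hij, ldlt]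
    push_cast
    exact Finset.sum_range (fun k => (ent L i k : ℝ) * (D.getD k 0 : ℝ) * (ent L j k : ℝ))
  have hsum : ∑ i : Fin n, ∑ j : Fin n, (M i j : ℝ) * v i * v j = v ⬝ᵥ (Mm *ᵥ v) := by
    rw [dotProduct_mulVec_eq_sum]
    simp only [hMm0, Matrix.of_apply]
  rw [hsum, hMm, ← Matrix.mulVec_mulVec, ← Matrix.mulVec_mulVec, Matrix.dotProduct_mulVec,
    Matrix.mulVec_transpose]
  simp only [dotProduct, Matrix.mulVec_diagonal]
  refine Finset.sum_nonneg fun k _ => ?_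
  have hk : 0 ≤ d k := by simp only [hd]; exact_mod_cast hD k k.isLt
  have : (v ᵥ* Lm) k * (d k * (v ᵥ* Lm) k) = d k * (v ᵥ* Lm) k ^ 2 := by ring
  rw [this]
  positivity

/-! ## Soundness, step 2: the cubic remainder -/
/-- Each coordinate is bounded by the Euclidean norm. -/
theorem abs_le_sqrt_sum_sq {n : ℕ} (v : Fin n → ℝ) (i : Fin n) : |v i| ≤ Real.sqrt (∑ j, v j ^ 2) := by
  apply Real.abs_le_sqrt
  exact Finset.single_le_sum (f := fun j => v j ^ 2) (fun j _ => sq_nonneg (v j)) (Finset.mem_univ i)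

/-- The quadratic part is bounded by `‖Q‖₁ ρ²`, `ρ² = Σ vᵢ²`. -/
theorem abs_quad_le (m : QuadModel) (v : Fin m.n → ℝ) (i : Fin m.n) :
    |m.quad v i| ≤ (m.qNorm1 : ℝ) * (∑ j, v j ^ 2) := by
  set ρ := Real.sqrt (∑ j, v j ^ 2) with hρ
  have hρ0 : 0 ≤ ρ := Real.sqrt_nonneg _
  have hρ2 : ρ ^ 2 = ∑ j, v j ^ 2 := Real.sq_sqrt (Finset.sum_nonneg fun j _ => sq_nonneg (v j))
  have hv : ∀ j, |v j| ≤ ρ := fun j => abs_le_sqrt_sum_sq v j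
  have h1 : |m.quad v i| ≤ ∑ j : Fin m.n, ∑ k : Fin m.n, |(m.q i j k : ℝ)| * ρ ^ 2 := by
    unfold QuadModel.quad
    refine (Finset.abs_sum_le_sum_abs _ _).trans (Finset.sum_le_sum fun j _ => ?_)
    refine (Finset.abs_sum_le_sum_abs _ _).trans (Finset.sum_le_sum fun k _ => ?_)
    rw [abs_mul, abs_mul]
    calc |(m.q i j k : ℝ)| * |v j| * |v k| ≤ |(m.q i j k : ℝ)| * ρ * ρ := by
          gcongr
          · exact hv j
          · exact hv k
      _ = |(m.q i j k : ℝ)| * ρ ^ 2 := by ring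
  have h2 : ∑ j : Fin m.n, ∑ k : Fin m.n, |(m.q i j k : ℝ)| ≤ (m.qNorm1 : ℝ) := by
    have : (m.qNorm1 : ℝ) = ∑ i' : Fin m.n, ∑ j : Fin m.n, ∑ k : Fin m.n, |(m.q i' j k : ℝ)| := by
      unfold QuadModel.qNorm1
      push_cast
      rw [Finset.sum_range (fun i' => ∑ j ∈ range m.n, ∑ k ∈ range m.n, |(m.q i' j k : ℝ)|)]
      refine Finset.sum_congr rfl fun i' _ => ?_
      rw [Finset.sum_range (fun j => ∑ k ∈ range m.n, |(m.q i' j k : ℝ)|)]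
      refine Finset.sum_congr rfl fun j _ => ?_
      rw [Finset.sum_range]
    rw [this]
    exact Finset.single_le_sum (f := fun i' : Fin m.n => ∑ j : Fin m.n, ∑ k : Fin m.n, |(m.q i' j k : ℝ)|)
      (fun i' _ => Finset.sum_nonneg fun j _ => Finset.sum_nonneg fun k _ => abs_nonneg _) (Finset.mem_univ i)
  calc |m.quad v i| ≤ ∑ j : Fin m.n, ∑ k : Fin m.n, |(m.q i j k : ℝ)| * ρ ^ 2 := h1
    _ = (∑ j : Fin m.n, ∑ k : Fin m.n, |(m.q i j k : ℝ)|) * ρ ^ 2 := by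
        rw [Finset.sum_mul]; refine Finset.sum_congr rfl fun j _ => ?_; rw [Finset.sum_mul]
    _ ≤ (m.qNorm1 : ℝ) * ρ ^ 2 := by gcongr
    _ = (m.qNorm1 : ℝ) * (∑ j, v j ^ 2) := by rw [hρ2]

/-- The cubic remainder of `V'` is bounded by `2‖P‖₁‖Q‖₁ ρ³ ≤ 2‖P‖₁‖Q‖₁ Mth ρ²` on the ball. -/
theorem abs_cubic_le (r : LyapRow) (v : Fin r.n → ℝ) {Mth : ℝ} (hMth : 0 ≤ Mth)
    (hball : ∑ j, v j ^ 2 ≤ Mth ^ 2) :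
    |∑ i : Fin r.n, ∑ j : Fin r.n, (r.p i j : ℝ) * (r.model.quad v i * v j + v i * r.model.quad v j)| ≤
      2 * (r.pNorm1 : ℝ) * (r.model.qNorm1 : ℝ) * Mth * ∑ j, v j ^ 2 := by
  set E := ∑ j, v j ^ 2 with hE
  have hE0 : 0 ≤ E := Finset.sum_nonneg fun j _ => sq_nonneg (v j)
  set ρ := Real.sqrt E with hρ
  have hρ0 : 0 ≤ ρ := Real.sqrt_nonneg _
  have hρM : ρ ≤ Mth := by
    rw [hρ, ← Real.sqrt_sq hMth]
    exact Real.sqrt_le_sqrt hball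
  have hv : ∀ j, |v j| ≤ ρ := fun j => abs_le_sqrt_sum_sq v j
  have hq : ∀ i, |r.model.quad v i| ≤ (r.model.qNorm1 : ℝ) * E := fun i => abs_quad_le r.model v i
  have hQ0 : 0 ≤ (r.model.qNorm1 : ℝ) := by
    have : (0 : ℚ) ≤ r.model.qNorm1 := by
      unfold QuadModel.qNorm1
      exact Finset.sum_nonneg fun _ _ => Finset.sum_nonneg fun _ _ => Finset.sum_nonneg fun _ _ => abs_nonneg _
    exact_mod_cast this
  have hterm : ∀ i j : Fin r.n,
      |(r.p i j : ℝ) * (r.model.quad v i * v j + v i * r.model.quad v j)| ≤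
        |(r.p i j : ℝ)| * (2 * (r.model.qNorm1 : ℝ) * E * ρ) := by
    intro i j
    rw [abs_mul]
    refine mul_le_mul_of_nonneg_left ?_ (abs_nonneg _)
    calc |r.model.quad v i * v j + v i * r.model.quad v j|
        ≤ |r.model.quad v i * v j| + |v i * r.model.quad v j| := abs_add_le _ _
      _ = |r.model.quad v i| * |v j| + |v i| * |r.model.quad v j| := by rw [abs_mul, abs_mul]
      _ ≤ (r.model.qNorm1 : ℝ) * E * ρ + ρ * ((r.model.qNorm1 : ℝ) * E) := by
          gcongr
          · exact hq i
          · exact hv j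
          · exact hv i
          · exact hq j
      _ = 2 * (r.model.qNorm1 : ℝ) * E * ρ := by ring
  have hP : (r.pNorm1 : ℝ) = ∑ i : Fin r.n, ∑ j : Fin r.n, |(r.p i j : ℝ)| := by
    unfold LyapRow.pNorm1
    push_cast
    rw [Finset.sum_range (fun i => ∑ j ∈ range r.n, |(r.p i j : ℝ)|)]
    refine Finset.sum_congr rfl fun i _ => ?_
    rw [Finset.sum_range]
  calc |∑ i : Fin r.n, ∑ j : Fin r.n, (r.p i j : ℝ) * (r.model.quad v i * v j + v i * r.model.quad v j)|
      ≤ ∑ i : Fin r.n, ∑ j : Fin r.n, |(r.p i j : ℝ)| * (2 * (r.model.qNorm1 : ℝ) * E * ρ) := by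
        refine (Finset.abs_sum_le_sum_abs _ _).trans (Finset.sum_le_sum fun i _ => ?_)
        exact (Finset.abs_sum_le_sum_abs _ _).trans (Finset.sum_le_sum fun j _ => hterm i j)
    _ = (r.pNorm1 : ℝ) * (2 * (r.model.qNorm1 : ℝ) * E * ρ) := by
        rw [hP, Finset.sum_mul]; refine Finset.sum_congr rfl fun i _ => ?_; rw [Finset.sum_mul]
    _ ≤ (r.pNorm1 : ℝ) * (2 * (r.model.qNorm1 : ℝ) * E * Mth) := by
        have hP0 : 0 ≤ (r.pNorm1 : ℝ) := by
          rw [hP]; exact Finset.sum_nonneg fun _ _ => Finset.sum_nonneg fun _ _ => abs_nonneg _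
        gcongr
    _ = 2 * (r.pNorm1 : ℝ) * (r.model.qNorm1 : ℝ) * Mth * E := by ring

/-! ## Soundness, step 3: the linear part is `xᵀ(AᵀP + PA)x ≤ −κ|x|²` -/
/-- The real matrices of a row. -/
def LyapRow.Pm (r : LyapRow) : Matrix (Fin r.n) (Fin r.n) ℝ := fun i j => (r.p i j : ℝ)

/-- The real linear part of a row's model. -/
def LyapRow.Am (r : LyapRow) : Matrix (Fin r.n) (Fin r.n) ℝ := fun i j => (r.model.a i j : ℝ)

/-- The linear part of the derivative of `V = xᵀPx` along `x' = Ax + q` is `xᵀ(AᵀP + PA)x`. -/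
theorem linear_part_eq (r : LyapRow) (v : Fin r.n → ℝ) :
    ∑ i : Fin r.n, ∑ j : Fin r.n, (r.p i j : ℝ) * ((r.Am *ᵥ v) i * v j + v i * (r.Am *ᵥ v) j) =
      v ⬝ᵥ ((r.Amᵀ * r.Pm + r.Pm * r.Am) *ᵥ v) := by
  have h1 : ∑ i : Fin r.n, ∑ j : Fin r.n, (r.p i j : ℝ) * ((r.Am *ᵥ v) i * v j) =
      v ⬝ᵥ ((r.Amᵀ * r.Pm) *ᵥ v) := by
    rw [← Matrix.mulVec_mulVec, Matrix.dotProduct_mulVec, Matrix.vecMul_transpose]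
    simp only [dotProduct]
    refine Finset.sum_congr rfl fun i _ => ?_
    have : (r.Pm *ᵥ v) i = ∑ j : Fin r.n, (r.p i j : ℝ) * v j := by
      simp [Matrix.mulVec, dotProduct, LyapRow.Pm]
    rw [this, Finset.mul_sum]
    refine Finset.sum_congr rfl fun j _ => ?_
    ring
  have h2 : ∑ i : Fin r.n, ∑ j : Fin r.n, (r.p i j : ℝ) * (v i * (r.Am *ᵥ v) j) =
      v ⬝ᵥ ((r.Pm * r.Am) *ᵥ v) := by
    rw [← Matrix.mulVec_mulVec]
    simp only [dotProduct]
    refine Finset.sum_congr rfl fun i _ => ?_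
    have : (r.Pm *ᵥ (r.Am *ᵥ v)) i = ∑ j : Fin r.n, (r.p i j : ℝ) * (r.Am *ᵥ v) j := by
      simp only [Matrix.mulVec, dotProduct, LyapRow.Pm]
    rw [this, Finset.mul_sum]
    refine Finset.sum_congr rfl fun j _ => ?_
    ring
  rw [Matrix.add_mulVec, dotProduct_add, ← h1, ← h2, ← Finset.sum_add_distrib]
  refine Finset.sum_congr rfl fun i _ => ?_
  rw [← Finset.sum_add_distrib]
  refine Finset.sum_congr rfl fun j _ => ?_
  ring

/-- The quadratic form of the certified matrix `−(AᵀP + PA) − κI`. -/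
theorem sMat_quadForm (r : LyapRow) (v : Fin r.n → ℝ) :
    ∑ i : Fin r.n, ∑ j : Fin r.n, (r.sMat i j : ℝ) * v i * v j =
      -(∑ i : Fin r.n, ∑ j : Fin r.n, (r.p i j : ℝ) * ((r.Am *ᵥ v) i * v j + v i * (r.Am *ᵥ v) j)) -
        (r.κ : ℝ) * ∑ i, v i ^ 2 := by
  rw [linear_part_eq, dotProduct_mulVec_eq_sum]
  have hentry : ∀ i j : Fin r.n, (r.sMat i j : ℝ) =
      -((r.Amᵀ * r.Pm + r.Pm * r.Am) i j) - if (i : ℕ) = (j : ℕ) then (r.κ : ℝ) else 0 := by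
    intro i j
    simp only [LyapRow.sMat, Matrix.add_apply, Matrix.mul_apply, Matrix.transpose_apply, LyapRow.Am,
      LyapRow.Pm]
    push_cast
    rw [Finset.sum_range (fun k => ((r.model.a k i : ℝ) * (r.p k j : ℝ) + (r.p i k : ℝ) * (r.model.a k j : ℝ))),
      Finset.sum_add_distrib]
    split_ifs <;> simp
  have hdiag : ∑ i : Fin r.n, ∑ j : Fin r.n, (if (i : ℕ) = (j : ℕ) then (r.κ : ℝ) else 0) * v i * v j =
      (r.κ : ℝ) * ∑ i, v i ^ 2 := by
    rw [Finset.mul_sum]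
    refine Finset.sum_congr rfl fun i _ => ?_
    rw [Finset.sum_eq_single i]
    · rw [if_pos rfl]; ring
    · intro j _ hji
      have : (i : ℕ) ≠ (j : ℕ) := fun h => hji (Fin.ext h).symm
      simp [this]
    · intro hi; exact absurd (Finset.mem_univ i) hi
  calc ∑ i : Fin r.n, ∑ j : Fin r.n, (r.sMat i j : ℝ) * v i * v j
      = ∑ i : Fin r.n, ∑ j : Fin r.n,
          (-((r.Amᵀ * r.Pm + r.Pm * r.Am) i j) * v i * v j -
            (if (i : ℕ) = (j : ℕ) then (r.κ : ℝ) else 0) * v i * v j) := by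
        refine Finset.sum_congr rfl fun i _ => Finset.sum_congr rfl fun j _ => ?_
        rw [hentry]; ring
    _ = -(∑ i : Fin r.n, ∑ j : Fin r.n, (r.Amᵀ * r.Pm + r.Pm * r.Am) i j * v i * v j) -
          (r.κ : ℝ) * ∑ i, v i ^ 2 := by
        rw [← hdiag]
        simp only [Finset.sum_sub_distrib, neg_mul, Finset.sum_neg_distrib]

/-- **SOUNDNESS of a model row** (finite-dimensional Lyapunov lemma; no PDE content): a passing row's
model has no non-zero periodic orbit whose Euclidean Galerkin energy stays below the row's threshold. -/
theorem LyapRow.sound (r : LyapRow) (h : r.check = true) :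
    ModelNoPeriodicOrbitBelow r.model (r.Mth : ℝ) := by
  simp only [LyapRow.check, Bool.and_eq_true, decide_eq_true_eq] at h
  obtain ⟨⟨⟨⟨-, h2⟩, -⟩, hMth⟩, hthr⟩ := h
  intro S x hS hper hode hball s₀
  set C : ℝ := 2 * (r.pNorm1 : ℝ) * (r.model.qNorm1 : ℝ) * (r.Mth : ℝ) with hC
  have hκC : C < (r.κ : ℝ) := by rw [hC]; exact_mod_cast hthr
  have hMth0 : (0 : ℝ) ≤ (r.Mth : ℝ) := by exact_mod_cast hMth.le
  have hE0 : ∀ s, 0 ≤ ∑ i, x s i ^ 2 := fun s => Finset.sum_nonneg fun i _ => sq_nonneg _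
  set V : ℝ → ℝ := fun s => ∑ i : Fin r.n, ∑ j : Fin r.n, (r.p i j : ℝ) * x s i * x s j with hVdef
  set V' : ℝ → ℝ := fun s => ∑ i : Fin r.n, ∑ j : Fin r.n,
      (r.p i j : ℝ) * (r.model.field (x s) i * x s j + x s i * r.model.field (x s) j) with hV'def
  have hV : ∀ s, HasDerivAt V (V' s) s := by
    intro s
    have hxi : ∀ i : Fin r.n, HasDerivAt (fun τ => x τ i) (r.model.field (x s) i) s :=
      fun i => (hasDerivAt_pi.mp (hode s)) i
    have hterm : ∀ i j : Fin r.n, HasDerivAt (fun τ => (r.p i j : ℝ) * x τ i * x τ j)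
        ((r.p i j : ℝ) * (r.model.field (x s) i * x s j + x s i * r.model.field (x s) j)) s := by
      intro i j
      exact (((hxi i).const_mul (r.p i j : ℝ)).mul (hxi j)).congr_deriv (by ring)
    exact HasDerivAt.fun_sum (u := Finset.univ) fun i _ =>
      HasDerivAt.fun_sum (u := Finset.univ) fun j _ => hterm i j
  have hV'le : ∀ s, V' s ≤ -((r.κ : ℝ) - C) * ∑ i, x s i ^ 2 := by
    intro s
    have hf : ∀ i, r.model.field (x s) i = (r.Am *ᵥ x s) i + r.model.quad (x s) i := by
      intro i
      simp [QuadModel.field, LyapRow.Am, Matrix.mulVec, dotProduct]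
    have hsplit : V' s =
        (∑ i : Fin r.n, ∑ j : Fin r.n, (r.p i j : ℝ) * ((r.Am *ᵥ x s) i * x s j + x s i * (r.Am *ᵥ x s) j)) +
          ∑ i : Fin r.n, ∑ j : Fin r.n,
            (r.p i j : ℝ) * (r.model.quad (x s) i * x s j + x s i * r.model.quad (x s) j) := by
      rw [hV'def, ← Finset.sum_add_distrib]
      refine Finset.sum_congr rfl fun i _ => ?_
      rw [← Finset.sum_add_distrib]
      refine Finset.sum_congr rfl fun j _ => ?_
      rw [hf i, hf j]
      ring
    have hlin : ∑ i : Fin r.n, ∑ j : Fin r.n,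
        (r.p i j : ℝ) * ((r.Am *ᵥ x s) i * x s j + x s i * (r.Am *ᵥ x s) j) ≤ -(r.κ : ℝ) * ∑ i, x s i ^ 2 := by
      have hpsd := psd_of_psdCheck h2 (x s)
      rw [sMat_quadForm] at hpsd
      linarith
    have hcub := (le_abs_self _).trans (abs_cubic_le r (x s) hMth0 (hball s))
    rw [hsplit]
    have : -((r.κ : ℝ) - C) * ∑ i, x s i ^ 2 = -(r.κ : ℝ) * ∑ i, x s i ^ 2 + C * ∑ i, x s i ^ 2 := by ring
    rw [this]
    exact add_le_add hlin hcub
  have hVdiff : Differentiable ℝ V := fun s => (hV s).differentiableAt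
  have hanti : Antitone V := by
    refine antitone_of_deriv_nonpos hVdiff fun s => ?_
    rw [(hV s).deriv]
    refine (hV'le s).trans ?_
    have : 0 ≤ ((r.κ : ℝ) - C) * ∑ i, x s i ^ 2 := mul_nonneg (by linarith) (hE0 s)
    linarith
  have hVper : Function.Periodic V S := by
    intro s
    simp only [hVdef, hper s]
  have hconst : ∀ s t, V s = V t := by
    suffices key : ∀ s t, s ≤ t → V s = V t by
      intro s t
      rcases le_total s t with hst | hts
      · exact key s t hst
      · exact (key t s hts).symm
    intro s t hst
    obtain ⟨k, hk⟩ := Archimedean.arch (t - s) hS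
    have h1 : V t ≤ V s := hanti hst
    have h2 : V (s + k • S) = V s := (hVper.nsmul k) s
    have h3 : V (s + k • S) ≤ V t := hanti (by linarith)
    linarith
  have hV'zero : V' s₀ = 0 := by
    have hc : HasDerivAt V 0 s₀ := by
      have hfun : V = fun _ => V 0 := funext fun t => hconst t 0
      rw [hfun]
      exact hasDerivAt_const s₀ (V 0)
    exact (hV s₀).unique hc
  have hE : ∑ i, x s₀ i ^ 2 = 0 := by
    have h := hV'le s₀
    rw [hV'zero] at h
    have hpos : 0 < (r.κ : ℝ) - C := by linarith
    nlinarith [hE0 s₀]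
  funext i
  have hi := (Finset.sum_eq_zero_iff_of_nonneg (fun j _ => sq_nonneg (x s₀ j))).mp hE i (Finset.mem_univ i)
  exact (pow_eq_zero_iff (two_ne_zero)).mp hi

/-- Self-test (kernel): the toy row (`n = 2`, `A = −I`, `Q₁ = x₁x₂`-type coupling, `P = I`, `κ = 1`,
`Mth = 1/10`; `P − I = 0 = L·0·Lᵀ`, `−(AᵀP + PA) − κI = I = L·1·Lᵀ`, `2·2·2·(1/10) < 1`) passes. -/
example : (LyapRow.mk (QuadModel.mk 2 0 "toy" #[#[-1, 0], #[0, -1]] #[#[#[0, 1], #[0, 0]], #[#[0, 0], #[1, 0]]])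
    #[#[1, 0], #[0, 1]] 1 (1 / 10) #[#[1, 0], #[0, 1]] #[0, 0] #[#[1, 0], #[0, 1]] #[1, 1]).check = true := by
  decide +kernel

end Summit.NavierStokesRegularity.NavierStokesRegularity.Cruxes.ScarEnvelopeTypeI.DssWindowCert

end
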